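import Mathlib.MeasureTheory.Integral.Prod
import Literature.Probability.Process.CondExpInvariance
import Literature.MathematicalPhysics.QuantumFieldTheory.Balaban1983to89.UnitaryModel
import Literature.MathematicalPhysics.QuantumFieldTheory.Balaban1983to89.B12SmallFieldDomain259
import HarnessLib

/-!
# Route RevelationMartingale — TREE GAUGE: revealing a bond with a FRESH vertex does not move the conditional expectation
# of a gauge-invariant observable (the «spanning tree first — zero increments by gauge invariance» step of LINE 13)

Cell `ym3-torus` (YM ladder rung R3 = continuum SU(2) Yang–Mills on the three-torus — a RUNG of the programme, NOT d = 4, NOT the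
Clay problem), width seat `ym-ust-19936-w4` gen 9; line «revelation_martingale» (skeleton `Cruxes/HistoryTailL/Lines/revelation_martingale.lean`
v3) on the crux `HistoryTailL` (stmt-QuantumFields-19936); helper file, `--supports stmt-QuantumFields-19936`.  Nothing here proves a
stub, the deciding crux 23082, `HistoryTailL` or any summit statement.  The line's card («Idea») takes as filtration the BOND
REVELATION along an enumeration `e : Fin N → PBond (F.P K) 0` — «spanning tree first — zero increments by gauge invariance — then
loop-closing bonds outward from ∂p»; this file is the first half of that sentence as a kernel theorem, for EVERY gauge-invariant law
and observable:

* §1 (pure measure theory, any finite measure space) ★`condExp_comap_ae_eq_of_orbitAverage`: if a family of `μ`-preserving maps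
  `τ_h` (`h` ranging over a probability space) fixes `f` and a map `X`, acts on a finer map `X′ ⊒ X` through a jointly measurable
  `act`, and the orbit average `h ↦ 1_T(act h (X′ ω))` of every `X′`-event integrates to a function of `X ω` («the action is
  transitive on the new coordinate, fixes the old ones, the averaging measure is invariant»), then `μ[f | σ(X′)] = μ[f | σ(X)]` a.e.
  (change of variables + Fubini, transport of conditional expectations under measure-preserving maps — tree
  ✓`Literature.Probability.Process.condExp_comp_of_measurePreserving`, imported —, pull-out and a.e. uniqueness from Mathlib).
* §2 (gauge fields over `Setup`, any `Params`, any gauge group with `HaarData` ∕ `RegularGaugeGroup`):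
  ★★`condExp_bondReveal_succ_ae_eq_of_freshVertex` — for a finite measure `μ` preserved by all gauge transformations, a gauge-invariant
  integrable `f`, an enumeration `e` and the masked-revelation σ-algebras `σ_i = σ(U ↦ (m ↦ if m < i then U (e m) else 1))` of
  ✓`RevelationMartingaleBondFiltration`: if `e i` has an endpoint `x` touched by no `e m`, `m < i`, then `μ[f | σ_(i+1)] = μ[f | σ_i]`
  a.e.  Proof: the single-site gauge rotations at `x` by a Haar-distributed `h` preserve `μ` and `f`, fix every revealed bond, and move
  `U(e i) ↦ h·U(e i)` (fresh initial point) or `U(e i) ↦ U(e i)·h⁻¹` (fresh final point); left∕right∕inversion invariance of Haar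
  makes the rotation average of any `σ_(i+1)`-event a `σ_i`-observable, and §1 applies.
The gauge invariance of the Wilson–Gibbs law and the stubs' letters (`gibbsK`, `dist1(Ū^j(∂p))`, the `Filtration`, the MGF clause
with proxy `σ_i = 0`, forest prefixes) are in the sibling file `RevelationMartingaleFreshVertexZeroIncrementT3`.

COUNT (for the instrument row's `N_eff`): with the enumeration ordered «spanning tree first» the first `#Site − 1` increments vanish,
so at most `N_eff = #PBond − #Site + 1` proxies are non-zero; on the level-0 torus of `F.P K` (`d = 3`, `n = sitesPerDir 0 = 2·L^(m+K)`,
`#Site = n³`, `#PBond = 3n³`) this is `N_eff = 2n³ + 1 = 16·L^(3(m+K)) + 1`, the cyclomatic number of the torus graph (prose only).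
HONEST SCOPE: a mechanism step (Elitzur's orbit average ∕ the maximal-tree gauge — M. Creutz, *Quarks, gluons and lattices* (1983)
ch. 9; S. Elitzur, Phys. Rev. D 12 (1975) 3978 — in conditional-expectation form on `Setup.GaugeField`); it prices the forest part of
the revelation at exactly `0` and says NOTHING about the loop-closing increments, the window, or the proxy sum `≤ Cv·g_(K−j)²`, which
is where both bond stubs' content lives.  Mathlib + tree only; def-free. [folklore]
-/

namespace Summit.QuantumFields.YangMills.Theorems.RevelationMartingaleTreeGauge

open scoped BigOperators Classical MeasureTheory
open MeasureTheory Set Filter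

/-! ## §1 Pure measure theory: conditional expectations and orbit averages of a measure-preserving family -/

section OrbitAverage

variable {Ω A A' H : Type*} [mΩ : MeasurableSpace Ω] [mA : MeasurableSpace A] [mA' : MeasurableSpace A']
  [MeasurableSpace H] {μ : Measure Ω} {ν : Measure H}

omit mΩ mA' in
/-- The indicator of a preimage `X′⁻¹ T` is the indicator of `T` read through `X′`, times the function. [folklore] -/
theorem indicator_preimage_eq_mul (X' : Ω → A') (T : Set A') (g : Ω → ℝ) (ω : Ω) :
    (X' ⁻¹' T).indicator g ω = T.indicator (fun _ => (1 : ℝ)) (X' ω) * g ω := by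
  by_cases h : X' ω ∈ T
  · rw [indicator_of_mem (mem_preimage.mpr h), indicator_of_mem h, one_mul]
  · rw [indicator_of_notMem (fun h' => h (mem_preimage.mp h')), indicator_of_notMem h, zero_mul]

omit mA' in
/-- An indicator integrates to a number in `[0, 1]` against a probability measure. [folklore] -/
theorem abs_integral_indicator_one_le_one [IsProbabilityMeasure ν] (S : H → A') (T : Set A') :
    |∫ h, T.indicator (fun _ => (1 : ℝ)) (S h) ∂ν| ≤ 1 := by
  rw [abs_of_nonneg (integral_nonneg fun h => indicator_nonneg (fun _ _ => zero_le_one) _)]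
  calc ∫ h, T.indicator (fun _ => (1 : ℝ)) (S h) ∂ν ≤ ∫ _h, (1 : ℝ) ∂ν :=
        integral_mono_of_nonneg (Eventually.of_forall fun h => indicator_nonneg (fun _ _ => zero_le_one) _)
          (integrable_const 1) (Eventually.of_forall fun h => indicator_le_self' (fun _ _ => zero_le_one) _)
    _ = 1 := by rw [integral_const, probReal_univ, one_smul]

/-- **ORBIT AVERAGE.**  Let `τ_h` (`h ∈ H`, `ν` a probability measure on `H`) be `μ`-preserving maps, `X′` a measurable map that is
`τ`-EQUIVARIANT for a jointly measurable `act : H → A′ → A′` (`X′ ∘ τ_h = act h ∘ X′`), and `g` an integrable function with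
`g ∘ τ_h = g` a.e. for every `h`.  Then for every measurable `T ⊆ A′` the weight `1_T(X′)` may be replaced by its ORBIT AVERAGE:
`∫ 1_T(X′ ω) g(ω) dμ = ∫ (∫ 1_T(act h (X′ ω)) dν(h)) g(ω) dμ` (change of variables `ω ↦ τ_h ω` for each `h`, then Fubini).
[folklore] -/
theorem integral_indicator_mul_eq_orbitAverage [IsFiniteMeasure μ] [IsProbabilityMeasure ν]
    (τ : H → Ω → Ω) (hτ : ∀ h, MeasurePreserving (τ h) μ μ)
    {X' : Ω → A'} (hX' : Measurable X') (act : H → A' → A')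
    (hact : Measurable fun q : H × A' => act q.1 q.2)
    (hX'τ : ∀ h ω, X' (τ h ω) = act h (X' ω))
    {g : Ω → ℝ} (hg : Integrable g μ) (hgτ : ∀ h, (g ∘ τ h) =ᵐ[μ] g)
    {T : Set A'} (hT : MeasurableSet T) :
    ∫ ω, T.indicator (fun _ => (1 : ℝ)) (X' ω) * g ω ∂μ =
      ∫ ω, (∫ h, T.indicator (fun _ => (1 : ℝ)) (act h (X' ω)) ∂ν) * g ω ∂μ := by
  have hind : Measurable (T.indicator (fun _ => (1 : ℝ))) := measurable_const.indicator hT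
  -- Step 1: change of variables along each `τ_h`
  have h1 : ∀ h, ∫ ω, T.indicator (fun _ => (1 : ℝ)) (X' ω) * g ω ∂μ =
      ∫ ω, T.indicator (fun _ => (1 : ℝ)) (act h (X' ω)) * g ω ∂μ := by
    intro h
    have hF : AEStronglyMeasurable (fun ω => T.indicator (fun _ => (1 : ℝ)) (X' ω) * g ω) (Measure.map (τ h) μ) := by
      rw [(hτ h).map_eq]
      exact (hind.comp hX').aestronglyMeasurable.mul hg.aestronglyMeasurable
    calc ∫ ω, T.indicator (fun _ => (1 : ℝ)) (X' ω) * g ω ∂μ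
        = ∫ ω, T.indicator (fun _ => (1 : ℝ)) (X' ω) * g ω ∂(Measure.map (τ h) μ) := by rw [(hτ h).map_eq]
      _ = ∫ ω, T.indicator (fun _ => (1 : ℝ)) (X' (τ h ω)) * g (τ h ω) ∂μ :=
          integral_map (hτ h).measurable.aemeasurable hF
      _ = ∫ ω, T.indicator (fun _ => (1 : ℝ)) (act h (X' ω)) * g ω ∂μ := by
          refine integral_congr_ae ?_
          filter_upwards [hgτ h] with ω hω
          rw [hX'τ h ω, ← hω, Function.comp_apply]
  -- Step 2: average over the orbit and swap the integrals
  have hΦm : Measurable fun q : H × Ω => T.indicator (fun _ => (1 : ℝ)) (act q.1 (X' q.2)) :=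
    hind.comp (hact.comp (measurable_fst.prodMk (hX'.comp measurable_snd)))
  have hΦint : Integrable (Function.uncurry fun h ω => T.indicator (fun _ => (1 : ℝ)) (act h (X' ω)) * g ω) (ν.prod μ) := by
    refine Integrable.bdd_mul (c := 1) (hg.comp_snd ν) hΦm.aestronglyMeasurable (Eventually.of_forall fun q => ?_)
    rw [Real.norm_eq_abs]
    by_cases hq : act q.1 (X' q.2) ∈ T
    · rw [indicator_of_mem hq, abs_one]
    · rw [indicator_of_notMem hq, abs_zero]; exact zero_le_one
  calc ∫ ω, T.indicator (fun _ => (1 : ℝ)) (X' ω) * g ω ∂μ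
      = ∫ h, (∫ ω, T.indicator (fun _ => (1 : ℝ)) (act h (X' ω)) * g ω ∂μ) ∂ν := by
        have hc : (fun h => ∫ ω, T.indicator (fun _ => (1 : ℝ)) (act h (X' ω)) * g ω ∂μ) =
            fun _ => ∫ ω, T.indicator (fun _ => (1 : ℝ)) (X' ω) * g ω ∂μ := funext fun h => (h1 h).symm
        rw [hc, integral_const, probReal_univ, one_smul]
    _ = ∫ ω, (∫ h, T.indicator (fun _ => (1 : ℝ)) (act h (X' ω)) * g ω ∂ν) ∂μ := integral_integral_swap hΦint
    _ = ∫ ω, (∫ h, T.indicator (fun _ => (1 : ℝ)) (act h (X' ω)) ∂ν) * g ω ∂μ := by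
        refine integral_congr_ae (Eventually.of_forall fun ω => ?_)
        exact integral_mul_const (g ω) _

/-- **CONDITIONAL EXPECTATIONS DO NOT SEE A COORDINATE THAT A SYMMETRY RANDOMISES.**  Let `τ_h` (`h ∈ H`, `ν` a probability measure
on `H`) be `μ`-preserving maps of a finite measure space, `f` an integrable `τ`-invariant function, `X : Ω → A` a `τ`-INVARIANT
measurable map and `X′ : Ω → A′` a `τ`-EQUIVARIANT one (`X′ ∘ τ_h = act h ∘ X′`, `act` jointly measurable) generating a LARGER σ-algebra,
`σ(X) ≤ σ(X′)`.  If the orbit average of every `X′`-event is an `X`-observable — for every measurable `T ⊆ A′` there is a measurable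
`ψ_T : A → ℝ` with `∫ 1_T(act h (X′ ω)) dν(h) = ψ_T(X ω)` for all `ω` — then `μ[f | σ(X′)] = μ[f | σ(X)]` a.e.: the extra information
in `X′` is pure noise for `f`.  (For `S = X′⁻¹ T`: `∫_S f = ∫ ψ_T(X)·f = ∫ ψ_T(X)·μ[f|σ(X)] = ∫_S μ[f|σ(X)]` by the orbit average applied
to `f` and to `μ[f|σ(X)]` — itself `τ`-invariant by transport of conditional expectations — and the pull-out property; uniqueness.)
[folklore] -/
theorem condExp_comap_ae_eq_of_orbitAverage [IsFiniteMeasure μ] [IsProbabilityMeasure ν]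
    (τ : H → Ω → Ω) (hτ : ∀ h, MeasurePreserving (τ h) μ μ)
    {X : Ω → A} {X' : Ω → A'} (hX : Measurable X) (hX' : Measurable X')
    (hle : mA.comap X ≤ mA'.comap X')
    (hXτ : ∀ h ω, X (τ h ω) = X ω)
    (act : H → A' → A') (hact : Measurable fun q : H × A' => act q.1 q.2)
    (hX'τ : ∀ h ω, X' (τ h ω) = act h (X' ω))
    (havg : ∀ T : Set A', MeasurableSet T → ∃ ψ : A → ℝ, Measurable ψ ∧
        ∀ ω, ∫ h, T.indicator (fun _ => (1 : ℝ)) (act h (X' ω)) ∂ν = ψ (X ω))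
    {f : Ω → ℝ} (hf : Integrable f μ) (hfτ : ∀ h ω, f (τ h ω) = f ω) :
    μ[f | mA'.comap X'] =ᵐ[μ] μ[f | mA.comap X] := by
  have hm : mA.comap X ≤ mΩ := hX.comap_le
  have hm' : mA'.comap X' ≤ mΩ := hX'.comap_le
  set Z : Ω → ℝ := μ[f | mA.comap X] with hZdef
  have hZint : Integrable Z μ := integrable_condExp
  have hZsm : StronglyMeasurable[mA.comap X] Z := stronglyMeasurable_condExp
  -- `Z` is `τ`-invariant (transport of conditional expectations under the measure-preserving `τ_h`)
  have hZτ : ∀ h, (Z ∘ τ h) =ᵐ[μ] Z := by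
    intro h
    have hfc : f ∘ τ h = f := funext (hfτ h)
    have hXc : X ∘ τ h = X := funext (hXτ h)
    have ht := Literature.Probability.Process.condExp_comp_of_measurePreserving (hτ h) hX hf
    rw [hfc, hXc] at ht
    exact ht.symm
  have hfτ' : ∀ h, (f ∘ τ h) =ᵐ[μ] f := fun h => Eventually.of_forall fun ω => hfτ h ω
  -- the set-integral identity on `σ(X′)`-sets
  refine (ae_eq_condExp_of_forall_setIntegral_eq hm' hf (fun s _ _ => hZint.integrableOn) ?_
    (hZsm.mono hle).aestronglyMeasurable).symm
  rintro _ ⟨T, hT, rfl⟩ -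
  obtain ⟨ψ, hψm, hψ⟩ := havg T hT
  have hψX : StronglyMeasurable[mA.comap X] (fun ω => ψ (X ω)) :=
    (hψm.comp (measurable_iff_comap_le.mpr le_rfl)).stronglyMeasurable
  have hψb : ∀ ω, ‖ψ (X ω)‖ ≤ 1 := fun ω => by
    rw [Real.norm_eq_abs, ← hψ ω]; exact abs_integral_indicator_one_le_one _ T
  have hψf : Integrable (fun ω => ψ (X ω) * f ω) μ :=
    hf.bdd_mul (hψm.comp hX).aestronglyMeasurable (Eventually.of_forall hψb)
  -- both set integrals equal `∫ ψ(X)·g`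
  have hS : ∀ {g : Ω → ℝ}, Integrable g μ → (∀ h, (g ∘ τ h) =ᵐ[μ] g) →
      ∫ ω in X' ⁻¹' T, g ω ∂μ = ∫ ω, ψ (X ω) * g ω ∂μ := by
    intro g hg hgτ
    rw [← integral_indicator (hX' hT)]
    simp_rw [indicator_preimage_eq_mul X' T g]
    rw [integral_indicator_mul_eq_orbitAverage (ν := ν) τ hτ hX' act hact hX'τ hg hgτ hT]
    exact integral_congr_ae (Eventually.of_forall fun ω => by simp only [hψ ω])
  rw [hS hZint hZτ, hS hf hfτ']
  -- pull-out: `∫ ψ(X)·μ[f|σ(X)] = ∫ μ[ψ(X)·f|σ(X)] = ∫ ψ(X)·f`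
  have hpull : μ[(fun ω => ψ (X ω) * f ω) | mA.comap X] =ᵐ[μ] fun ω => ψ (X ω) * Z ω :=
    condExp_mul_of_stronglyMeasurable_left hψX hψf hf
  calc ∫ ω, ψ (X ω) * Z ω ∂μ = ∫ ω, (μ[(fun ω => ψ (X ω) * f ω) | mA.comap X]) ω ∂μ := (integral_congr_ae hpull).symm
    _ = ∫ ω, ψ (X ω) * f ω ∂μ := integral_condExp hm

end OrbitAverage

/-! ## §2 Gauge fields: single-site gauge rotations and the bond revelation -/

section GaugeFields

open Literature.MathematicalPhysics.QuantumFieldTheory.Balaban1983to89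

variable {P : Params} {G : Type*} [GaugeGroup G] [MeasurableSpace G] [RegularGaugeGroup G] [HaarData G]

omit [MeasurableSpace G] [RegularGaugeGroup G] [HaarData G] in
/-- A single-site gauge rotation `u = (h at x, 1 elsewhere)` does not move a bond avoiding `x`. [folklore] -/
theorem gaugeAct_single_apply_of_ne (x : Site P 0) (h : G) (U : GaugeField P 0 G) {b : PBond P 0}
    (hs : b.src ≠ x) (ht : b.tgt ≠ x) :
    GaugeField.gaugeAct (fun y => if y = x then h else (1 : G)) U b = U b := by
  simp [GaugeField.gaugeAct, hs, ht]

omit [MeasurableSpace G] [RegularGaugeGroup G] [HaarData G] in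
/-- … multiplies a bond issuing from `x` on the LEFT by `h` … [folklore] -/
theorem gaugeAct_single_apply_of_src (x : Site P 0) (h : G) (U : GaugeField P 0 G) {b : PBond P 0}
    (hs : b.src = x) :
    GaugeField.gaugeAct (fun y => if y = x then h else (1 : G)) U b = h * U b := by
  have ht : b.tgt ≠ x := fun h' => B12SmallFieldDomain259.src_ne_tgt b (hs.trans h'.symm)
  simp [GaugeField.gaugeAct, hs, ht]

omit [MeasurableSpace G] [RegularGaugeGroup G] [HaarData G] in
/-- … and a bond ending at `x` on the RIGHT by `h⁻¹`. [folklore] -/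
theorem gaugeAct_single_apply_of_tgt (x : Site P 0) (h : G) (U : GaugeField P 0 G) {b : PBond P 0}
    (ht : b.tgt = x) :
    GaugeField.gaugeAct (fun y => if y = x then h else (1 : G)) U b = U b * h⁻¹ := by
  have hs : b.src ≠ x := fun h' => B12SmallFieldDomain259.src_ne_tgt b (h'.trans ht.symm)
  simp [GaugeField.gaugeAct, hs, ht]

omit [HaarData G] in
/-- The single-site rotation is jointly measurable in (group element, configuration). [folklore] -/
theorem measurable_gaugeAct_single (x : Site P 0) :
    Measurable fun q : G × GaugeField P 0 G =>
      GaugeField.gaugeAct (fun y => if y = x then q.1 else (1 : G)) q.2 := by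
  refine measurable_pi_lambda _ fun b => ?_
  have hb : Measurable fun q : G × GaugeField P 0 G => q.2 b := (measurable_pi_apply b).comp measurable_snd
  by_cases hs : b.src = x
  · have heq : (fun q : G × GaugeField P 0 G => GaugeField.gaugeAct (fun y => if y = x then q.1 else (1 : G)) q.2 b) =
        fun q => q.1 * q.2 b :=
      funext fun q => gaugeAct_single_apply_of_src x q.1 q.2 hs
    rw [heq]
    exact measurable_fst.mul hb
  · by_cases ht : b.tgt = x
    · have heq : (fun q : G × GaugeField P 0 G => GaugeField.gaugeAct (fun y => if y = x then q.1 else (1 : G)) q.2 b) =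
          fun q => q.2 b * q.1⁻¹ := funext fun q => gaugeAct_single_apply_of_tgt x q.1 q.2 ht
      rw [heq]; exact hb.mul measurable_fst.inv
    · have heq : (fun q : G × GaugeField P 0 G => GaugeField.gaugeAct (fun y => if y = x then q.1 else (1 : G)) q.2 b) =
          fun q => q.2 b := funext fun q => gaugeAct_single_apply_of_ne x q.1 q.2 hs ht
      rw [heq]; exact hb

/-- Haar averaging kills a left factor: `∫ F(h·g) dh = ∫ F(h) dh`. [folklore] -/
theorem integral_haar_comp_mul_right (g : G) {F : G → ℝ} (hF : Measurable F) :
    ∫ h, F (h * g) ∂(HaarData.haar : Measure G) = ∫ h, F h ∂(HaarData.haar : Measure G) := by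
  have hφ : Measurable fun h : G => h * g := measurable_mul_const g
  rw [← integral_map hφ.aemeasurable (hF.aestronglyMeasurable), HaarData.map_mul_right g]

/-- Haar averaging kills a right inverse factor: `∫ F(g·h⁻¹) dh = ∫ F(h) dh`. [folklore] -/
theorem integral_haar_comp_mul_inv_left (g : G) {F : G → ℝ} (hF : Measurable F) :
    ∫ h, F (g * h⁻¹) ∂(HaarData.haar : Measure G) = ∫ h, F h ∂(HaarData.haar : Measure G) := by
  have hφ : Measurable fun h : G => g * h := measurable_const_mul g
  have hG : AEStronglyMeasurable (fun y : G => F (g * y)) (Measure.map (fun h : G => h⁻¹) (HaarData.haar : Measure G)) :=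
    (hF.comp hφ).aestronglyMeasurable
  have h1 : ∫ h, F (g * h⁻¹) ∂(HaarData.haar : Measure G) =
      ∫ y, F (g * y) ∂(Measure.map (fun h : G => h⁻¹) (HaarData.haar : Measure G)) :=
    (integral_map (measurable_inv (G := G)).aemeasurable hG).symm
  rw [h1, HaarData.map_inv, ← integral_map hφ.aemeasurable hF.aestronglyMeasurable, HaarData.map_mul_left g]

/-- **FRESH VERTEX ⇒ ZERO INCREMENT (any gauge-invariant law, any gauge-invariant observable).**  Let `μ` be a finite measure on
the finest-level gauge fields preserved by every gauge transformation, `f` a `μ`-integrable GAUGE-INVARIANT observable, `e : Fin N →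
PBond P 0` an enumeration of bonds and `σ_i` the σ-algebra generated by the masked revelation `U ↦ (m ↦ if m < i then U (e m) else 1)`
(the bond-revelation filtration of LINE 13, ✓`exists_bondFiltration`).  If the `i`-th bond `e i` has an endpoint `x` that is an
endpoint of NO earlier bond `e m`, `m < i`, then revealing it does not change the conditional expectation of `f`:
`μ[f | σ_(i+1)] = μ[f | σ_i]` a.e.  (The single-site gauge rotations at `x` by Haar-distributed `h` preserve `μ` and `f`, fix the
revealed bonds and move `U(e i) ↦ h·U(e i)` (resp. `U(e i)·h⁻¹`); by the translation invariance of Haar the rotation-average of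
any `σ_(i+1)`-event is a `σ_i`-observable, and §1 applies.) [folklore] -/
theorem condExp_bondReveal_succ_ae_eq_of_freshVertex (μ : Measure (GaugeField P 0 G)) [IsFiniteMeasure μ]
    (hμ : ∀ u : GaugeTransf P 0 G, MeasurePreserving (GaugeField.gaugeAct u) μ μ)
    {f : GaugeField P 0 G → ℝ} (hf : Integrable f μ) (hfinv : GaugeField.GaugeInvariant f)
    {N : ℕ} (e : Fin N → PBond P 0) {i : ℕ} (hi : i < N) {x : Site P 0}
    (hx : (e ⟨i, hi⟩).src = x ∨ (e ⟨i, hi⟩).tgt = x)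
    (hfresh : ∀ m : Fin N, (m : ℕ) < i → (e m).src ≠ x ∧ (e m).tgt ≠ x) :
    μ[f | MeasurableSpace.comap
        (fun (U : GaugeField P 0 G) (m : Fin N) => if (m : ℕ) < i + 1 then U (e m) else (1 : G)) inferInstance]
      =ᵐ[μ] μ[f | MeasurableSpace.comap
        (fun (U : GaugeField P 0 G) (m : Fin N) => if (m : ℕ) < i then U (e m) else (1 : G)) inferInstance] := by
  haveI : IsProbabilityMeasure (HaarData.haar : Measure G) := HaarData.isProb
  -- the symmetry family: single-site rotations at `x`
  set τ : G → GaugeField P 0 G → GaugeField P 0 G :=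
    fun h => GaugeField.gaugeAct (fun y => if y = x then h else (1 : G)) with hτdef
  -- the two revelation maps: measurable, nested (cf. ✓`RevelationMartingaleBondFiltration`, kept import-free here)
  have hmask : ∀ k : ℕ, Measurable (fun (v : Fin N → G) (m : Fin N) => if (m : ℕ) < k then v m else (1 : G)) := by
    intro k
    refine measurable_pi_lambda _ fun m => ?_
    by_cases h : (m : ℕ) < k
    · simp only [h, if_true]; exact measurable_pi_apply m
    · simp only [h, if_false]; exact measurable_const
  have hpull : Measurable (fun (U : GaugeField P 0 G) (m : Fin N) => U (e m)) :=
    measurable_pi_lambda _ fun m => measurable_pi_apply (e m)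
  have hrev : ∀ k : ℕ, (fun (U : GaugeField P 0 G) (m : Fin N) => if (m : ℕ) < k then U (e m) else (1 : G)) =
      (fun (v : Fin N → G) (m : Fin N) => if (m : ℕ) < k then v m else (1 : G)) ∘ (fun U m => U (e m)) := fun k => rfl
  have hcut : (fun (U : GaugeField P 0 G) (m : Fin N) => if (m : ℕ) < i then U (e m) else (1 : G)) =
      (fun (v : Fin N → G) (m : Fin N) => if (m : ℕ) < i then v m else (1 : G)) ∘
        (fun (U : GaugeField P 0 G) (m : Fin N) => if (m : ℕ) < i + 1 then U (e m) else (1 : G)) := by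
    funext U m
    simp only [Function.comp_apply]
    by_cases h1 : (m : ℕ) < i
    · have h2 : (m : ℕ) < i + 1 := Nat.lt_succ_of_lt h1
      simp only [h1, h2, if_true]
    · simp only [h1, if_false]
  have hle : MeasurableSpace.comap (fun (U : GaugeField P 0 G) (m : Fin N) => if (m : ℕ) < i then U (e m) else (1 : G))
        (inferInstance : MeasurableSpace (Fin N → G)) ≤
      MeasurableSpace.comap (fun (U : GaugeField P 0 G) (m : Fin N) => if (m : ℕ) < i + 1 then U (e m) else (1 : G))
        (inferInstance : MeasurableSpace (Fin N → G)) := by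
    rw [hcut, ← MeasurableSpace.comap_comp]
    exact MeasurableSpace.comap_mono (hmask i).comap_le
  set X : GaugeField P 0 G → (Fin N → G) := fun U m => if (m : ℕ) < i then U (e m) else (1 : G) with hXdef
  set X' : GaugeField P 0 G → (Fin N → G) := fun U m => if (m : ℕ) < i + 1 then U (e m) else (1 : G) with hX'def
  have hX : Measurable X := by rw [hXdef, hrev i]; exact (hmask i).comp hpull
  have hX' : Measurable X' := by rw [hX'def, hrev (i + 1)]; exact (hmask (i + 1)).comp hpull
  have hXτ : ∀ h U, X (τ h U) = X U := by
    intro h U; funext m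
    by_cases hm : (m : ℕ) < i
    · simp only [hXdef, hm, if_true, hτdef]
      exact gaugeAct_single_apply_of_ne x h U (hfresh m hm).1 (hfresh m hm).2
    · simp only [hXdef, hm, if_false]
  have hfτ : ∀ h U, f (τ h U) = f U := fun h U => hfinv _ U
  have hmi : ∀ m : Fin N, (m : ℕ) = i → m = ⟨i, hi⟩ := fun m hm => Fin.ext hm
  -- the coordinates `m ≠ i` of `X′` are those of `X`
  have hX'X : ∀ U (m : Fin N), (m : ℕ) ≠ i → X' U m = X U m := by
    intro U m hm
    by_cases hlt : (m : ℕ) < i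
    · have : (m : ℕ) < i + 1 := Nat.lt_succ_of_lt hlt
      simp only [hX'def, hXdef, hlt, this, if_true]
    · have : ¬ (m : ℕ) < i + 1 := by omega
      simp only [hX'def, hXdef, hlt, this, if_false]
  have hX'i : ∀ U, X' U ⟨i, hi⟩ = U (e ⟨i, hi⟩) := fun U => by
    simp only [hX'def, Nat.lt_succ_self, if_true]
  -- measurability of the «replace coordinate i» map
  have hRm : Measurable fun q : G × (Fin N → G) => (fun m : Fin N => if (m : ℕ) = i then q.1 else q.2 m) := by
    refine measurable_pi_lambda _ fun m => ?_
    by_cases hm : (m : ℕ) = i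
    · simp only [hm, if_true]; exact measurable_fst
    · simp only [hm, if_false]; exact (measurable_pi_apply m).comp measurable_snd
  -- the orbit-average witness `ψ_T`
  have hψ : ∀ T : Set (Fin N → G), MeasurableSet T →
      Measurable fun v : Fin N → G =>
        ∫ h, T.indicator (fun _ => (1 : ℝ)) (fun m : Fin N => if (m : ℕ) = i then h else v m) ∂(HaarData.haar : Measure G) := by
    intro T hT
    have hu : StronglyMeasurable (Function.uncurry fun (v : Fin N → G) (h : G) =>
        T.indicator (fun _ => (1 : ℝ)) (fun m : Fin N => if (m : ℕ) = i then h else v m)) := by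
      refine Measurable.stronglyMeasurable ?_
      exact (measurable_const.indicator hT).comp (hRm.comp (measurable_snd.prodMk measurable_fst))
    exact (StronglyMeasurable.integral_prod_right hu).measurable
  rcases hx with hsrc | htgt
  · -- `x` is the initial point of `e i`: the revealed coordinate is multiplied on the left
    set act : G → (Fin N → G) → (Fin N → G) := fun h v m => if (m : ℕ) = i then h * v m else v m with hactdef
    have hact : Measurable fun q : G × (Fin N → G) => act q.1 q.2 := by
      refine measurable_pi_lambda _ fun m => ?_
      by_cases hm : (m : ℕ) = i
      · simp only [hactdef, hm, if_true]; exact measurable_fst.mul ((measurable_pi_apply m).comp measurable_snd)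
      · simp only [hactdef, hm, if_false]; exact (measurable_pi_apply m).comp measurable_snd
    have hX'τ : ∀ h U, X' (τ h U) = act h (X' U) := by
      intro h U; funext m
      by_cases hm : (m : ℕ) = i
      · have hm' := hmi m hm
        subst hm'
        simp only [hactdef, if_true, hX'i, hτdef]
        exact gaugeAct_single_apply_of_src x h U hsrc
      · rw [show act h (X' U) m = X' U m by simp only [hactdef, hm, if_false], hX'X _ m hm, hX'X _ m hm]
        exact congrFun (hXτ h U) m
    refine condExp_comap_ae_eq_of_orbitAverage (ν := (HaarData.haar : Measure G)) τ (fun h => hμ _) hX hX' hle hXτ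
      act hact hX'τ (fun T hT => ⟨_, hψ T hT, fun U => ?_⟩) hf hfτ
    -- orbit average: `∫ 1_T(act h (X′ U)) dh = ψ_T (X U)` by right-invariance of Haar
    have hR : ∀ h, act h (X' U) = (fun m : Fin N => if (m : ℕ) = i then h * U (e ⟨i, hi⟩) else X U m) := by
      intro h; funext m
      by_cases hm : (m : ℕ) = i
      · have hm' := hmi m hm; subst hm'; simp only [hactdef, if_true, hX'i]
      · simp only [hactdef, hm, if_false, hX'X U m hm]
    simp_rw [hR]
    exact integral_haar_comp_mul_right (U (e ⟨i, hi⟩))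
      ((measurable_const.indicator hT).comp (hRm.comp (measurable_id.prodMk measurable_const)))
  · -- `x` is the final point of `e i`: the revealed coordinate is multiplied on the right by `h⁻¹`
    set act : G → (Fin N → G) → (Fin N → G) := fun h v m => if (m : ℕ) = i then v m * h⁻¹ else v m with hactdef
    have hact : Measurable fun q : G × (Fin N → G) => act q.1 q.2 := by
      refine measurable_pi_lambda _ fun m => ?_
      by_cases hm : (m : ℕ) = i
      · simp only [hactdef, hm, if_true]
        exact ((measurable_pi_apply m).comp measurable_snd).mul measurable_fst.inv
      · simp only [hactdef, hm, if_false]; exact (measurable_pi_apply m).comp measurable_snd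
    have hX'τ : ∀ h U, X' (τ h U) = act h (X' U) := by
      intro h U; funext m
      by_cases hm : (m : ℕ) = i
      · have hm' := hmi m hm
        subst hm'
        simp only [hactdef, if_true, hX'i, hτdef]
        exact gaugeAct_single_apply_of_tgt x h U htgt
      · rw [show act h (X' U) m = X' U m by simp only [hactdef, hm, if_false], hX'X _ m hm, hX'X _ m hm]
        exact congrFun (hXτ h U) m
    refine condExp_comap_ae_eq_of_orbitAverage (ν := (HaarData.haar : Measure G)) τ (fun h => hμ _) hX hX' hle hXτ
      act hact hX'τ (fun T hT => ⟨_, hψ T hT, fun U => ?_⟩) hf hfτ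
    have hR : ∀ h, act h (X' U) = (fun m : Fin N => if (m : ℕ) = i then U (e ⟨i, hi⟩) * h⁻¹ else X U m) := by
      intro h; funext m
      by_cases hm : (m : ℕ) = i
      · have hm' := hmi m hm; subst hm'; simp only [hactdef, if_true, hX'i]
      · simp only [hactdef, hm, if_false, hX'X U m hm]
    simp_rw [hR]
    exact integral_haar_comp_mul_inv_left (U (e ⟨i, hi⟩))
      ((measurable_const.indicator hT).comp (hRm.comp (measurable_id.prodMk measurable_const)))

end GaugeFields

end Summit.QuantumFields.YangMills.Theorems.RevelationMartingaleTreeGauge
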